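import Summits.MatrixMultiplication.MatrixMultiplication.Theorems.AbelianSTPPCensusShapeCertVQKGSearchP
import Summits.MatrixMultiplication.MatrixMultiplication.Theorems.AbelianSTPPCensusLeafTE476Closed

/-!
# Abelian STPP census — from the route vocabulary to the checker `ShapeCertVQ.checkQKG` (vQKG := vP ∧ E3⁺ ∧ E3K ∧ U11-G′), and the leaf glue

Cell mm-stpp, rung F-M1; census-silent kernel ENABLER for the tranche-2 device band on `T_E` (orders `≥ 477`), in support of the closed crux
item stmt-MatrixMultiplication-19191; seat mm-stpp-vp-p2 (gen 9).  The one-order bridge for the checker `checkQKG` of `…ShapeCertVQKGDefs`, after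
vp-p2 g3's `ShapeCertVQ.shapeExclusionVQK_of_checkQK` (`…ShapeCertVQKFinal`: `inUniv_shp`, `admM_GM`, `admG_GM`, `admE_GM`, `admK_GM`,
`beats_gsumQ`) with `admGW_GM` (`…VQKGSemantics`) and `checkQKG_sound` (`…VQKGSearch`):
* `shapeExclusionVQKG_of_checkQKG` — **if `checkQKG M = true` (`M ≤ 489`) then no shape list with at least two members satisfying
  `SieveAdmissibleVP M`, `E3pAdm M`, `E3kAdm M` and `U11GPrime M` beats `5/2`** — and the same from the root path node
  (`shapeExclusionVQKG_of_pathOKKG`, for orders assembled from path segments);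
* `noAbelianSTPPHostUpTo_of_vqkg` — **leaf glue** (the shape of every `…LeafTE…Closed` file, once): a rung leaf `NoAbelianSTPPHostUpTo (5/2) M₀`
  and a vQKG shape exclusion at every order `M₀ < M ≤ M₁` give the rung leaf at `M₁`, because the shape data of every STPP family with
  non-empty sets is vP-admissible (`AbelianTECensus.sieveSound`, `u11GSound_holds`, `STPPRepCount.u11PSound`), E3⁺- (`e3pAdm_of_isSTPP`), E3K-
  (`e3kAdm_of_isSTPP`) and U11-G′-admissible (theory g13's `u11GPrime_of_isSTPP`).
WHAT THIS IS NOT: no certificate is run here, no order is certified, no census number moves (T_E's column of record stays `476`); no statement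
about `ω`; no new rule.
-/

set_option linter.dupNamespace false -- `MatrixMultiplication.MatrixMultiplication` (summit = problem, D-0017)
set_option autoImplicit false

namespace Summit.MatrixMultiplication.MatrixMultiplication.Theorems.ShapeCertVQ

open ShapeCert ShapeCertVP STPPThreeRoomEnergy Finset

/-- **From the checker `checkQKG` to the vQKG shape exclusion at one order.**  If `checkQKG M = true` (`M ≤ 489`), no shape list with at
least two members satisfying the vP sieve system, E3⁺ (`E3pAdm`), E3K (`E3kAdm`) and U11-G′ (`U11GPrime`) beats `5/2` at order `M`. [original] -/
theorem shapeExclusionVQKG_of_checkQKG {M : ℕ} (hM : M ≤ 489) (hc : checkQKG M = true) :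
    ∀ (N : ℕ) (a b c : Fin N → ℕ), 2 ≤ N → SieveAdmissibleVP M a b c → E3pAdm M a b c → E3kAdm M a b c → U11GPrime M a b c →
      ¬ Beats (5 / 2) M a b c := by
  intro N a b c hN hVP hE hK hW hB
  obtain ⟨hS, hG, -⟩ := hVP
  exact checkQKG_sound hc hM (GM a b c)
    (fun x hx => by obtain ⟨i, rfl⟩ := (mem_GM a b c).mp hx; exact inUniv_shp a b c hN hS i)
    (admM_GM a b c hN hS) (admG_GM a b c hS hG) (admE_GM a b c hE) (admK_GM a b c hK) (admGW_GM a b c hS hW)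
    (beats_gsumQ a b c hS hM hB)

/-- **The same from the root path node** (`PathOKKG M []`, assembled from kernel-evaluated path segments). [original] -/
theorem shapeExclusionVQKG_of_pathOKKG {M : ℕ} (hM : M ≤ 489) (h : PathOKKG M []) :
    ∀ (N : ℕ) (a b c : Fin N → ℕ), 2 ≤ N → SieveAdmissibleVP M a b c → E3pAdm M a b c → E3kAdm M a b c → U11GPrime M a b c →
      ¬ Beats (5 / 2) M a b c :=
  shapeExclusionVQKG_of_checkQKG hM (checkQKG_of_pathOKKG_nil h)

/-- **Leaf glue for vQKG certificates.**  A rung leaf `NoAbelianSTPPHostUpTo (5/2) M₀` and, at every order `M₀ < M ≤ M₁`, the vQKG shape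
exclusion (no shape list with `≥ 2` members that is vP-, E3⁺-, E3K- and U11-G′-admissible beats `5/2`) give the rung leaf at `M₁`: every STPP
family with non-empty sets has such shape data (`sieveSound`, `u11GSound_holds`, `u11PSound`, `e3pAdm_of_isSTPP`, `e3kAdm_of_isSTPP`,
`u11GPrime_of_isSTPP`), via `AbelianTECensus.noAbelianSTPPHostUpTo_of_two`.  Nothing is certified here. [original] -/
theorem noAbelianSTPPHostUpTo_of_vqkg {M₀ M₁ : ℕ} (hleaf : NoAbelianSTPPHostUpTo (5 / 2) M₀)
    (hcert : ∀ (N M : ℕ) (a b c : Fin N → ℕ), 2 ≤ N → M₀ < M → M ≤ M₁ →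
      SieveAdmissibleVP M a b c → E3pAdm M a b c → E3kAdm M a b c → U11GPrime M a b c → ¬ Beats (5 / 2) M a b c) :
    NoAbelianSTPPHostUpTo (5 / 2) M₁ := by
  classical
  refine AbelianTECensus.noAbelianSTPPHostUpTo_of_two (τ := 5 / 2) (by norm_num) (by norm_num) ?_
  intro H _ _ hM N A B C hS hne hN
  by_cases h0 : Fintype.card H ≤ M₀
  · exact hleaf H h0 N A B C hS
  · have hadm : SieveAdmissibleVP (Fintype.card H) (fun i => (A i).card) (fun i => (B i).card) (fun i => (C i).card) :=
      ⟨AbelianTECensus.sieveSound H N A B C hS hne, u11GSound_holds H N A B C hS hne,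
        fun hp => STPPRepCount.u11PSound H hp N A B C hS hne⟩
    have hE : E3pAdm (Fintype.card H) (fun i => (A i).card) (fun i => (B i).card) (fun i => (C i).card) :=
      e3pAdm_of_isSTPP hS hne
    have hK : E3kAdm (Fintype.card H) (fun i => (A i).card) (fun i => (B i).card) (fun i => (C i).card) :=
      e3kAdm_of_isSTPP hS hne
    have hW : U11GPrime (Fintype.card H) (fun i => (A i).card) (fun i => (B i).card) (fun i => (C i).card) :=
      u11GPrime_of_isSTPP hS hne
    have h := hcert N (Fintype.card H) _ _ _ hN (by omega) hM hadm hE hK hW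
    unfold Beats at h
    push Not at h
    simpa [shapeVol] using h

end Summit.MatrixMultiplication.MatrixMultiplication.Theorems.ShapeCertVQ
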